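import Mathlib.MeasureTheory.Function.LpSeminorm.Basic
import Mathlib.MeasureTheory.Measure.Haar.InnerProductSpace
import Literature.Analysis.FluidPDE.ClassicalSolution
import HarnessLib

/-!
# The `L^{9/2}` Liouville theorem for steady D-solutions on `ℝ³` (Galdi 2011, Thm. X.9.5)

Topic `Literature/Analysis/FluidPDE`. One NAMED FACT (D-0014, statement only):

* `Galdi2011_thmX95` — **Galdi's Liouville theorem.** A D-solution `v` of the stationary
  Navier–Stokes system on the whole space `ℝ³` with zero force,
  `(v·∇)v = −∇p + νΔv`, `div v = 0`, `|v(x)| → 0` as `|x| → ∞`, `∫ |∇v|² < ∞`, which moreover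
  belongs to `L^{9/2}(ℝ³)`, vanishes identically (G. P. Galdi, *An Introduction to the
  Mathematical Theory of the Navier–Stokes Equations: Steady-State Problems*, 2nd ed. (2011),
  Theorem X.9.5, p. 729). Locator and wording confirmed on the held text of D. Chae, J. Wolf,
  *On Liouville type theorems for the steady Navier–Stokes equations in ℝ³*, arXiv:1604.07643,
  p. 3: "A long standing open question is if any weak solution of (NS) satisfying the conditions
  (11) [`|v(x)| → 0`] and (12) [`∫|∇v|² < ∞`] is trivial … As a partial progress to the problem
  we mention that the condition `v ∈ L^{9/2}(ℝ³)` implies that `v = 0` (see Theorem X.9.5,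
  pp. 729 [Galdi])." (Chae–Wolf's Thm. 1.1 there removes the decay/Dirichlet hypotheses and
  weakens `L^{9/2}` logarithmically; we vendor only Galdi's form.)

## Typing (deliberately WEAKER than print)

* The printed theorem is for weak (D-)solutions; we state it for SMOOTH steady solutions, i.e.
  time-constant classical solutions of the tree's whole-space notion
  `IsClassicalNSSolutionOn univ ν 0 (fun _ => v) (fun _ => P)` (`ClassicalSolution.lean`).
* Print has `ν = 1`; the statement for every `ν > 0` follows by the scaling `w := v/ν`,
  `q := p/ν²`, which maps solutions to solutions of the `ν = 1` system and preserves all three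
  hypotheses.
* Decay (11) is `Tendsto v (cocompact _) (𝓝 0)`; the Dirichlet integral (12) is
  `Integrable (‖fderiv ℝ v ·‖²)`; `v ∈ L^{9/2}` is `MemLp v (9/2)` for Lebesgue measure on
  `EuclideanSpace ℝ (Fin 3)`.

## Use

Grounds the case `A = 0` of `Summit.AnomalousDissipation.AnomalousDissipation.Theses.TameDichotomy.StrainedLiouville`
(there `sup ‖y‖‖v y‖ < ∞` and smoothness give `v ∈ L^{9/2}` and the decay; the case `A ≠ 0`,
a linear strain background, is NOT covered by anything in print). Users take
`(h : Galdi2011_thmX95)`.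

## References

* [Galdi2011] G. P. Galdi, Springer Monographs in Mathematics (2011), Thm. X.9.5, p. 729.
* D. Chae, J. Wolf, J. Differential Equations 261 (2016) 5541–5560 = arXiv:1604.07643, p. 3.
-/

noncomputable section

namespace Literature.Analysis.FluidPDE

open _root_.MeasureTheory _root_.Filter
open scoped _root_.Topology _root_.ENNReal

/-- **Galdi's `L^{9/2}` Liouville theorem for steady D-solutions** (Galdi 2011, Thm. X.9.5,
p. 729; quoted in Chae–Wolf, arXiv:1604.07643, p. 3): for `ν > 0`, a smooth steady solution
`v : ℝ³ → ℝ³` (pressure `P`) of the unforced stationary Navier–Stokes system on the whole space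
with `|v(x)| → 0` at infinity, finite Dirichlet integral `∫ ‖∇v‖² < ∞` and `v ∈ L^{9/2}(ℝ³)` is
identically zero. Stated for classical (smooth) solutions — weaker than the printed D-solution
form. Grounds the `A = 0` case of
`Summit.AnomalousDissipation.AnomalousDissipation.Theses.TameDichotomy.StrainedLiouville`.
[cite: Galdi2011, Thm X.9.5 (p. 729)] -/
def Galdi2011_thmX95 : Prop :=
  ∀ (ν : ℝ) (v : EuclideanSpace ℝ (Fin 3) → EuclideanSpace ℝ (Fin 3))
    (P : EuclideanSpace ℝ (Fin 3) → ℝ), 0 < ν →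
    IsClassicalNSSolutionOn (Set.univ : Set ℝ) ν (fun _ _ => 0) (fun _ => v) (fun _ => P) →
    Tendsto v (cocompact (EuclideanSpace ℝ (Fin 3))) (𝓝 0) →
    Integrable (fun y => ‖fderiv ℝ v y‖ ^ 2) (volume : Measure (EuclideanSpace ℝ (Fin 3))) →
    MemLp v ((9 : ℝ≥0∞) / 2) (volume : Measure (EuclideanSpace ℝ (Fin 3))) →
    v = 0

end Literature.Analysis.FluidPDE

end
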